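import Summits.BirchSwinnertonDyer.Rank1Residual.X11b.ShapiroPairs
import HarnessLib

/-!
# BSD rank-≤1 residual cell, good SUPERSINGULAR reduction at `p = 3` with mod-3 image `3Nn` (normaliser of a NON-split Cartan,
# order 16, prime to 3) — family X7Three (X8Three = class X8, `a_3 = ±3`, cells N6 / O3; X7Three = X7 at 3, `a_3 = 0`, cells N5@3 / O4@3):
# `BSD(E,3)` per pair (`r_an ≤ 1`, `3 ∤ #Ш_an`, `N < 5·10⁵`) from PUBLISHED theorems + ONE EXACT 3-descent certificate line — batch 07 of 7 (SUPPLEMENT: the N5@3 rows that are EXACT in the full run kit j131308 but ERROR in the cells run kit j131863 of batches 01–06)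

HONEST FRAMING (cell `b2b-bsdres-*`, verbatim): prove what is provable now; shrink each hard class to its core with data;
no claim beyond stated classes; COMBINATION classes deleted from PUBLISHED theorems only, CONSTRUCTION-shaped remainder
typed; this is not "finishing BSD". X8 / X7 stay CONSTRUCTION-SHAPED; everything here is PER PAIR; no lane verdict is
changed; no named fact; nothing is booked by this unit (the owners / the lane / the referee decide). Unit
`b2b-bsdres-additive-p3` GEN 18 (prover-b2b-bsdres-additive-p3-g18-0; X8 prover B, CLASS-CLOSURE class lead N6·O3, X7
joint pair B side).

WHY (class lead's finding, class-closure/N6/WEEK-2026-08-28.md §11): the `3Nn` rows of N6 (70), O3 (6), N5@3 (112) and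
O4@3 (29) were carried as "no lever" because every Iwasawa / Euler-system route at `3` (Kato, Wuthrich Prop. 21, the
Kurihara numbers, Kim 2025) needs a large `3`-adic image and the Heegner-index route dies on the Tamagawa numbers
(harvest-1 g22–g24 `TAM-ONLY: index rows dead`). But on a row with `3 ∤ #Ш_an` the `3`-part of BSD is the statement
`Ш(E/ℚ)[3] = 0`, and the tree's CLASS-FREE consumer `Typed.bsdp_of_card_selmerGroup_eq_pow_analyticRank` (GZK + `r_an ≤ 1`
+ `3 ∤ #Ш_an` + the ONE line `#Sel^(3)(E/ℚ) = 3^{r_an}`; NO image hypothesis, NO Tamagawa condition — the Tamagawa factor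
sits inside `#Ш_an`) closes it from an exact `3`-descent, exactly as x11c GEN 15 did for the X4 `3Nn` rows
(`X4/NonsplitCartanThreeDescentRecords01–44.lean`, kit j126870).

ENGINE CREDIT: unit `b2b-bsdres-x11b` (prover-b2b-bsdres-x11b-g4, -g6, -g8): the exact-element 3-descent `desc3lib.gp`
(Schaefer–Stoll in the octic étale algebra `A = ℚ[x]/(ψ₃)`, one Galois orbit on `E[3]∖0`; sha256 c4fb20b7…,
BYTE-IDENTICAL) with its gen-8 driver `entry.gp` in EXACT mode (`bnfcertify(A) = 1` + 3-saturation of the S-units by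
cubic characters; every listed Selmer element exact; analytic rank re-computed by PARI; rank-1 rows: Cremona's generator
located in the computed Selmer group), audited for the X11b@3 census; unit `b2b-bsdres-x11c` GEN 15's kit wrapper
(`main.py` 78a19635…, `chunk_runner.py` 74b94fe3…, `entry.gp` 1efb1f5d…, `HOME/code/b2b-bsdres-x11c/gen15/desc3nnX4/`) —
ALL FOUR FILES RUN UNCHANGED by this unit (kit copy `HOME/b2b-bsdres-additive-p3/g18/desc3nnSS/`, only the curve list
is new) on a population its mathematics covers (`ψ₃` irreducible ⟸ image `3Nn` transitive on `E[3]∖0`; the local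
condition `dim E(ℚ_ℓ)/3E(ℚ_ℓ) = dim E(ℚ_ℓ)[3] + [ℓ = 3]` holds for every reduction type). Universe: ALL 1 673 Cremona curves
(`N < 5·10⁵`) with good reduction at `3`, `3 ∣ a_3` (supersingular), Sutherland/Cremona image code `3Nn` at `3`, rank `≤ 1`
(X8 `a_3 = ±3`: 619; `a_3 = 0`: 1 054); kit j131308 (pilot j131295 12/12); table
`HOME/b2b-bsdres-additive-p3/g18/desc3nnSS/SS3-3NN-TABLE.md`, certificates `j131308/certs.tar.gz`. THIS FILE = the rows that
are RESIDUAL CELLS OF RECORD (obsanat `class-closure/{N6,O3,N5,O4}/pairs.tsv`, `p = 3`, `img = Nn`) with mode EXACT,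
`dim Sel³(E/ℚ) = rank` and `3 ∤ #Ш_an`. SECOND IMPLEMENTATION (quoted per row where available): x11c GEN 15's `descentPlib.gp` FULL
(Maschke) mode at `p = 3` in the degree-8 field `R = ℚ(T′)` (files byte-identical to `HOME/code/b2b-bsdres-x11c/gen15/shapiroP3/`),
kit j131426, run by this unit on the same list.

What enters the kernel per pair is ONE line: `hSel : #Sel^(3)(E/ℚ) = 3 ^ r_an` of the tree's class-free consumer
`Typed.bsdp_of_card_selmerGroup_eq_pow_analyticRank` through x11c gen 12's `X11b.bsdp_of_ainvs_of_card_selmerGroup`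
(GZK `hGZK`, `r_an ≤ 1`, `3 ∤ #Ш_an`; `Δ ≠ 0` by `decide`). Non-kernel inputs per pair: `r_an`, `#Ш_an` (Cremona; the
cell's engines) and the certificate line. References: Schaefer–Stoll, Trans. AMS 356 (2004) [SchaeferStoll2004];
Silverman, *AEC* X.1, X.4 [SilvermanAEC2009]; Miller, LMS JCM 14 (2011) §1 [Miller2011LMS]; Cremona [Cremona2006].
-/

set_option autoImplicit false

noncomputable section

open scoped Classical

open WeierstrassCurve Literature.NumberTheory.EllipticCurves
  Literature.NumberTheory.EllipticCurves.Rank1Residual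
  Literature.NumberTheory.EllipticCurves.Rank1Residual.Typed
  Literature.NumberTheory.EllipticCurves.Rank1Residual.X11RankOneCertificates
  Summit.BirchSwinnertonDyer.Rank1Residual.X11b

namespace Summit.BirchSwinnertonDyer.Rank1Residual.Supersingular

/-- **`BSD(E,3)` for `211712f1`** [EXACT] (cell N5, class X7@3: `N = 211712`, good supersingular at `3`, `a_3 = 0`; Cremona model `[0, 0, 0, -6838, -216096]`; `ρ̄_{E,3}` = `3Nn`; rank `0`; `#Ш_an = 1`, `∏ c_ℓ = 6`)
from GZK and the certificate line `#Sel^(3)(E/ℚ) = 3 ^ r_an`: EXACT 3-descent (x11b `desc3lib.gp` via x11c's GEN-15 kit, run UNCHANGED by additive-p3 GEN 18, kit j131308):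
octic algebra `A = ℚ[x]/(ψ₃)` with `|d_A| ≈ 10^11`, `S = {2, 3, 827}`, `Cl(A) = [1, []]` CERTIFIED (`bnfcertify = 1`), `11` generators of `A(S,3)` (3-saturated by
cubic characters), `dim H¹(ℚ,E[3];S) = 2`, local images at every `ℓ ∈ S` reached, **`dim Sel^(3)(E/ℚ) = 0 = rank`** (PARI analytic-rank
datum `[0, 3.15161424053778]`) ⟹ **`#Sel^(3)(E/ℚ) = 3^0`**, mode `EXACT(bnfcertify1+3sat)`. Second implementation (x11c `descentPlib.gp` full mode, kit j131426): dim Sel³ = 0 [EXACT, K_S 0, Cl(R) [1, []]] — AGREES. Kernel: `Δ ≠ 0`. Binders: `hGZK`, `r_an ≤ 1`, `#Ш_an` a `3`-unit, `hSel`.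
[cite: Miller2011LMS, §1 and Def. 1.1] [cite: Cremona2006, Table 1 (Cremona label 211712f1)] -/
theorem bsdp3_nn211712f1 (hGZK : rank_eq_analyticRank_of_analyticRank_le_one)
    (W : WeierstrassCurve ℚ) (hW : W = ⟨0, 0, 0, -6838, -216096⟩)
    (hr : W.analyticRank ≤ 1) {q : ℚ} (hq : shaAn W = (q : ℂ)) (hv : padicValRat 3 q = 0)
    (hSel : Nat.card (W.selmerGroup (3 : ℤ)) = 3 ^ W.analyticRank) : BSDp W 3 := by
  subst hW
  haveI : Fact (Nat.Prime 3) := ⟨by norm_num⟩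
  exact bsdp_of_ainvs_of_card_selmerGroup hGZK 0 0 0 (-6838) (-216096) (by decide +kernel) 3 hr hq hv hSel

/-- **`BSD(E,3)` for `421645e1`** [EXACT] (cell N5, class X7@3: `N = 421645`, good supersingular at `3`, `a_3 = 0`; Cremona model `[1, -1, 0, -456519044, 3754602721183]`; `ρ̄_{E,3}` = `3Nn`; rank `0`; `#Ш_an = 1`, `∏ c_ℓ = 54`)
from GZK and the certificate line `#Sel^(3)(E/ℚ) = 3 ^ r_an`: EXACT 3-descent (x11b `desc3lib.gp` via x11c's GEN-15 kit, run UNCHANGED by additive-p3 GEN 18, kit j131308):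
octic algebra `A = ℚ[x]/(ψ₃)` with `|d_A| ≈ 10^8`, `S = {3, 5, 7, 1721}`, `Cl(A) = [1, []]` CERTIFIED (`bnfcertify = 1`), `16` generators of `A(S,3)` (3-saturated by
cubic characters), `dim H¹(ℚ,E[3];S) = 3`, local images at every `ℓ ∈ S` reached, **`dim Sel^(3)(E/ℚ) = 0 = rank`** (PARI analytic-rank
datum `[0, 4.79467836034640]`) ⟹ **`#Sel^(3)(E/ℚ) = 3^0`**, mode `EXACT(bnfcertify1+3sat)`. Second implementation (x11c `descentPlib.gp` full mode, kit j131426): dim Sel³ = 0 [EXACT, K_S 0, Cl(R) [1, []]] — AGREES. Kernel: `Δ ≠ 0`. Binders: `hGZK`, `r_an ≤ 1`, `#Ш_an` a `3`-unit, `hSel`.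
[cite: Miller2011LMS, §1 and Def. 1.1] [cite: Cremona2006, Table 1 (Cremona label 421645e1)] -/
theorem bsdp3_nn421645e1 (hGZK : rank_eq_analyticRank_of_analyticRank_le_one)
    (W : WeierstrassCurve ℚ) (hW : W = ⟨1, -1, 0, -456519044, 3754602721183⟩)
    (hr : W.analyticRank ≤ 1) {q : ℚ} (hq : shaAn W = (q : ℂ)) (hv : padicValRat 3 q = 0)
    (hSel : Nat.card (W.selmerGroup (3 : ℤ)) = 3 ^ W.analyticRank) : BSDp W 3 := by
  subst hW
  haveI : Fact (Nat.Prime 3) := ⟨by norm_num⟩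
  exact bsdp_of_ainvs_of_card_selmerGroup hGZK 1 (-1) 0 (-456519044) 3754602721183 (by decide +kernel) 3 hr hq hv hSel

end Summit.BirchSwinnertonDyer.Rank1Residual.Supersingular

end
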